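import Literature.Geometry.Symplectic.PlusOneSpherePair
import Literature.Geometry.Kaehler.ProjectiveLineSymplectic
import Literature.Topology.FourManifolds.BordismFourProjectivePlane
import Literature.Topology.FourManifolds.ComplexProjectiveSpaceProofs
import Literature.AlgebraicTopology.SingularHomology.ExcisionMayerVietoris
import Mathlib.Analysis.Convex.Contractible
import HarnessLib

/-!
# The model `(ℂℙ², ω_FS, ℂℙ¹)` of `mcduff_plusOneSphere_pairDiffeomorph`: the fact is not vacuous

Sibling proof file of `PlusOneSpherePair.lean` (named fact
`Literature.Geometry.Symplectic.mcduff_plusOneSphere_pairDiffeomorph`; McDuff 1990, Thm. 1.4 with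
Cor. 1.5 (i); Wendl 2018, Thm. D (2) = Thm. 6.9 (2)). Its module docstring asserts:
*"Conversely `(ℂP², line)` satisfies them (`H₂(ℂP²) = ℤ`, `ℂP² ∖ line = ℂ²`): not vacuous."*
This file PROVES that assertion, hypothesis by hypothesis, for the model

* `N = ℂℙ²` (`Literature.Topology.FourManifolds.ComplexProjectivePlane`, literal model `𝓡 4`),
* `s = ω_FS` (the Fubini–Study form `Literature.Geometry.Kaehler.CPn.fsForm 2` of
  `ComplexProjectiveSpaceFubiniStudy.lean`, read at the literal model),
* `S = ℂℙ¹` (`ComplexProjectiveSpace 1` at the literal model `𝓡 2`) and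
  `b = lineIncl : [v₀ : v₁] ↦ [v₀ : v₁ : 0]` (`ComplexProjectiveLineClutching.lean`),

by assembling theorems the tree already has:

| hypothesis of the fact | model instance | source in the tree |
|---|---|---|
| `IsSmoothForm s`, `IsClosedForm s` | `ω_FS` smooth, closed | `CPn.isSmoothForm_fsForm`, `CPn.isClosedForm_fsForm` |
| `s` non-degenerate | `ω_FS` symplectic | `CPn.fsForm_nondegenerate` |
| `b` smooth embedding | the line | `CPn.isSmoothEmbedding_lineIncl` |
| `b*s` non-degenerate | the line is symplectic | `CPn.fsForm_lineIncl_ne_zero` |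
| `S ≅ S²` | `ℂℙ¹ ≅ S²` | `nonempty_diffeomorph_complexProjectiveSpace_one_sphere_holds` |
| `rank H₂(N; ℤ) = 1` | `H₂(ℂℙ²; ℤ) ≅ ℤ` | `ComplexProjectivePlane.singularHomologyTwoIso` (Mayer–Vietoris) |
| `H₁(N ∖ b(S); ℤ) = 0` | `ℂℙ² ∖ ℂℙ¹ = U₂ ≅ ℝ⁴` | `CPn.range_lineIncl`, `isZero_singularHomology_of_contractibleSpace` |

(`model_isSmoothForm`, …, `model_subsingleton_H1` below), so that ANY witness `h` of the fact
applies to the model (`mcduff_plusOneSphere_pairDiffeomorph.apply_model`) — the eight hypotheses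
are simultaneously satisfiable, the fact is not vacuously true — and the conclusion it then yields
does hold there, by the identity (`PlusOneSpherePair.model_conclusion`). Everything is proved; no
definitions, no named facts.

## References

* D. McDuff, *The structure of rational and ruled symplectic 4-manifolds*, J. Amer. Math. Soc. 3
  (1990) 679–712, Thm. 1.4, Cor. 1.5 (i) [McDuff1990].
* C. Wendl, *Holomorphic Curves in Low Dimensions*, LNM 2216 (2018), §1.1 Example 1.4 and
  (1.4) (`[ℂP¹]·[ℂP¹] = 1`, the sphere at infinity), Thm. 6.9 (2) [Wendl2018].
* A. Hatcher, *Algebraic Topology* (2002), §2.2 p. 140 (`Hᵢ(ℂPⁿ)`) [HatcherAT2002].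
-/

noncomputable section

open scoped Manifold ContDiff Topology
open Set Function Module CategoryTheory CategoryTheory.Limits
open Literature.Topology.FourManifolds Literature.Topology.FourManifolds.ComplexProjectiveSpace
open Literature.Geometry.Kaehler Literature.AlgebraicTopology.SingularHomology

namespace Literature.Geometry.Symplectic

namespace PlusOneSpherePair

/- Throughout, the Fubini–Study form of `ℂℙ²` is read as a `2`-form at the literal model `𝓡 4` of
`ComplexProjectivePlane`, `(CPn.fsForm 2 : MForm (𝓡 4) ComplexProjectivePlane ℝ 2)` (the tangent
spaces `EuclideanSpace ℝ (Fin (2 * 2))` and `EuclideanSpace ℝ (Fin 4)` agree definitionally). -/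

/-! ### The eight hypotheses, for `(ℂℙ², ω_FS, ℂℙ¹ ⊂ ℂℙ²)` -/

/-- `ω_FS` is smooth (at the literal model `𝓡 4`).
[cite: HuybrechtsCG2005, §3.1 Examples 3.1.9 i) pp. 117–118] -/
theorem model_isSmoothForm :
    IsSmoothForm (I := 𝓡 4) (M := ComplexProjectivePlane)
      (CPn.fsForm 2 : MForm (𝓡 4) ComplexProjectivePlane ℝ 2) :=
  CPn.isSmoothForm_fsForm (n := 2)

/-- `ω_FS` is closed. [cite: HuybrechtsCG2005, §3.1 Examples 3.1.9 i) pp. 117–118] -/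
theorem model_isClosedForm :
    IsClosedForm (I := 𝓡 4) (M := ComplexProjectivePlane)
      (CPn.fsForm 2 : MForm (𝓡 4) ComplexProjectivePlane ℝ 2) :=
  CPn.isClosedForm_fsForm (n := 2)

/-- `ω_FS` is non-degenerate. [cite: HuybrechtsCG2005, §3.1 Examples 3.1.9 i) pp. 117–118] -/
theorem model_nondegenerate (x : ComplexProjectivePlane) (v : TangentSpace (𝓡 4) x) (hv : v ≠ 0) :
    ∃ w : TangentSpace (𝓡 4) x,
      (CPn.fsForm 2 : MForm (𝓡 4) ComplexProjectivePlane ℝ 2) x ![v, w] ≠ 0 :=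
  CPn.fsForm_nondegenerate (n := 2) x v hv

/-- The line is symplectic for `ω_FS`: `ι*ω_FS` is non-degenerate.
[cite: HuybrechtsCG2005, §3.1 Examples 3.1.9 i) pp. 117–118] -/
theorem model_symplecticLine (y : ComplexProjectiveSpace 1) (v : TangentSpace (𝓡 2) y) (hv : v ≠ 0) :
    ∃ w : TangentSpace (𝓡 2) y,
      (CPn.fsForm 2 : MForm (𝓡 4) ComplexProjectivePlane ℝ 2) (lineIncl y)
        ![mfderiv (𝓡 2) (𝓡 4) lineIncl y v, mfderiv (𝓡 2) (𝓡 4) lineIncl y w] ≠ 0 :=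
  CPn.fsForm_lineIncl_ne_zero y v hv

/-- `ℂℙ¹ ≅ S²` (at the literal model `𝓡 2` of `ℂℙ¹`).
[cite: GriffithsHarrisPrinciples1978, Ch. 0 §2 (ℂℙ¹ is the Riemann sphere)] -/
theorem model_sphere :
    Nonempty (ComplexProjectiveSpace 1 ≃ₘ⟮𝓡 2, 𝓡 2⟯ Metric.sphere (0 : EuclideanSpace ℝ (Fin 3)) 1) :=
  nonempty_diffeomorph_complexProjectiveSpace_one_sphere_holds

/-- **`rank H₂(ℂℙ²; ℤ) = 1`**, from the tree's `H₂(ℂℙ²; M) ≅ M`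
(`ComplexProjectivePlane.singularHomologyTwoIso`, Mayer–Vietoris). [cite: HatcherAT2002, §2.2 p. 140] -/
theorem model_finrank_H2 : Module.finrank ℤ (singularHomologyZ ComplexProjectivePlane 2) = 1 := by
  have e : singularHomologyZ ComplexProjectivePlane 2 ≅ ModuleCat.of ℤ ℤ :=
    ComplexProjectivePlane.singularHomologyTwoIso ℤ ℤ
  rw [LinearEquiv.finrank_eq e.toLinearEquiv]
  exact Module.finrank_self ℤ

/-- The complement of the line is the affine chart domain `U₂ = {z₂ ≠ 0} ≅ ℝ⁴`, hence
contractible. [cite: HuybrechtsCG2005, §2.1 pp. 56–57] -/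
theorem model_contractible_compl : ContractibleSpace ↥((range lineIncl)ᶜ) := by
  set e₂ := (affineChart (n := 2) 2 :
    OpenPartialHomeomorph ComplexProjectivePlane (EuclideanSpace ℝ (Fin 4))) with he₂
  have hs : (range lineIncl)ᶜ = e₂.source := by
    rw [CPn.range_lineIncl, affineChart_source]
    ext q
    simp only [mem_compl_iff, mem_setOf_eq, not_not]
  have ht : e₂.target = univ := affineChart_target (n := 2) 2
  have e : ↥((range lineIncl)ᶜ) ≃ₜ EuclideanSpace ℝ (Fin 4) :=
    ((Homeomorph.setCongr hs).trans e₂.toHomeomorphSourceTarget).trans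
      ((Homeomorph.setCongr ht).trans (Homeomorph.Set.univ (EuclideanSpace ℝ (Fin 4))))
  exact e.contractibleSpace

/-- **`H₁(ℂℙ² ∖ ℂℙ¹; ℤ) = 0`** (the complement is contractible).
[cite: HatcherAT2002, §2.1 Ex. 2.18 ff. (homology of a contractible space)] -/
theorem model_subsingleton_H1 : Subsingleton (singularHomologyZ (↥((range lineIncl)ᶜ)) 1) := by
  haveI := model_contractible_compl
  exact ModuleCat.subsingleton_of_isZero
    (isZero_singularHomology_of_contractibleSpace ℤ ℤ (X := ↥((range lineIncl)ᶜ)) one_ne_zero)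

/-! ### The fact applies to the model, and its conclusion holds there -/

/-- The conclusion of the fact holds for the model, by the identity: the line IS `{z₂ = 0}`.
[cite: Wendl2018, §1.1 (the sphere at infinity)] -/
theorem model_conclusion :
    ∃ Φ : ComplexProjectivePlane ≃ₘ⟮𝓡 4, 𝓡 4⟯ ComplexProjectivePlane,
      Φ '' (range lineIncl) = {y | ¬ CoordNeZero 2 y} :=
  ⟨Diffeomorph.refl _ _ _, by rw [Diffeomorph.coe_refl, image_id, CPn.range_lineIncl]⟩

end PlusOneSpherePair

open PlusOneSpherePair in
/-- **`mcduff_plusOneSphere_pairDiffeomorph` is not vacuous**: every witness of the fact applies to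
the model `(N, s, S, b) = (ℂℙ², ω_FS, ℂℙ¹, [v₀ : v₁] ↦ [v₀ : v₁ : 0])`, all eight hypotheses being
theorems of the tree there (`PlusOneSpherePair.model_isSmoothForm`, `model_isClosedForm`,
`model_nondegenerate`, `CPn.isSmoothEmbedding_lineIncl`, `model_symplecticLine`, `model_sphere`,
`model_finrank_H2`, `model_subsingleton_H1`); the conclusion so obtained is
`PlusOneSpherePair.model_conclusion`. [cite: McDuff1990, Thm. 1.4 + Cor. 1.5 (i), p. 682]
[cite: Wendl2018, §1.1 Example 1.4, Thm. 6.9 (2)] -/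
theorem mcduff_plusOneSphere_pairDiffeomorph.apply_model (h : mcduff_plusOneSphere_pairDiffeomorph) :
    ∃ Φ : ComplexProjectivePlane ≃ₘ⟮𝓡 4, 𝓡 4⟯ ComplexProjectivePlane,
      Φ '' (range lineIncl) = {y | ¬ CoordNeZero 2 y} :=
  h ComplexProjectivePlane (CPn.fsForm 2 : MForm (𝓡 4) ComplexProjectivePlane ℝ 2)
    (ComplexProjectiveSpace 1) lineIncl model_isSmoothForm model_isClosedForm model_nondegenerate
    CPn.isSmoothEmbedding_lineIncl model_symplecticLine model_sphere model_finrank_H2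
    model_subsingleton_H1

end Literature.Geometry.Symplectic
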